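import Literature.NumberTheory.Automorphic.BorelGoodPlaceModel
import Literature.NumberTheory.Automorphic.BorelHeckeLocalGL2
import Literature.NumberTheory.Automorphic.TwistedQuotientSubgroupModel
import Literature.NumberTheory.Automorphic.AdicCompletionCompact
import HarnessLib

/-!
# `T_{w,1}` restricted to the Borel model: `res ∘ T_{w,1} = (T^B_{diag(ϖ,1)} + T^B_{diag(1,ϖ)}) ∘ res`

Topic `NumberTheory/Automorphic`; namespace `Literature.NumberTheory.Automorphic`, grouping
sub-namespace `BigHeckeGLn`.

Let `K` be a number field, `S` a set of finite places, `w ∉ S`, `U ≤ GL₂(𝔸_K^∞)` a level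
unramified at `w` (`IsUnramifiedLevel GL₂(𝒪_w) ι_w (·)_w U`), `H_S = borelAwayFrom S`
(`BorelGoodPlaceModel`), `ϖ = ϖ_w` the fixed uniformiser, `t₁ = diag(ϖ, 1)`, `t₂ = diag(1, ϖ)`
and `t^B_1 = ι_w(t₁)`, `t^B_2 = ι_w(t₂) ∈ H_S` (`borelHeckeElement₁`, `borelHeckeElement₂`).
Proved here:

* `exists_residueSystem` — a finite system of representatives of `𝒪_w / ϖ` in `K_w`;
* `image_toQuot_doubleCosetQuot_ofBorelLocal` — the `H_S`-double coset of `ι_w(a)`, `a ∈ B(K_w)`,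
  pushed into `𝒢 ⧸ U`, is `{ι_w(l a) U : l ∈ B(K_w) ∩ GL₂(𝒪_w)}`;
* `doubleCosetQuot_heckeElement_one_eq` — **`U t_{w,1} U / U` is the disjoint union of the images
  of `(U ∩ H_S) t^B_1 (U ∩ H_S)` and `(U ∩ H_S) t^B_2 (U ∩ H_S)`** (from the local statement
  `orbit_heckeLocalDiag_eq` of `BorelHeckeLocalGL2` and the local–global coset correspondences of
  `U` and of `U ∩ H_S` at `w`), with the disjointness `disjoint_doubleCosetQuot_borelHeckeElement`
  and finiteness `finite_doubleCosetQuot_borelHeckeElement₁/₂`;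
* `subgroupRestrictMap_heckeEnd_heckeElement_one` — hence on twisted cohomology, for any `Γ → H_S`
  and coefficients: **`res (T_{w,1} x) = T^B_{t₁} (res x) + T^B_{t₂} (res x)`**
  (`TwistedQuotientSubgroupModel.subgroupRestrictMap_heckeEnd_apply`).

This is the Hecke-operator computation on the Borel stratum of [Harder1987, §2] at the finite
level, in the group-theoretic form "`K t₁ K = ⊔_β (ϖ β; 0 1) K ⊔ (1 0; 0 ϖ) K` read inside `B`".

## References

* G. Harder, *Eisenstein cohomology of arithmetic groups. The case GL₂*, Invent. Math. 89 (1987), §2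
  [Harder1987].
* D. Bump, *Automorphic forms and representations* (1997), §4.6, (6.4) [Bump1997].
-/

noncomputable section

open scoped NumberField
open IsDedekindDomain

namespace Literature.NumberTheory.Automorphic

/-! ### A residue system of `K_w` -/

section Residues

variable (K : Type) [Field K] [NumberField K] (w : HeightOneSpectrum (𝓞 K))

/-- **A finite residue system**: finitely many `b_i ∈ 𝒪_w` such that every element of `𝒪_w` is
congruent mod `𝓂_w` to exactly one `b_i` (the residue field of `K_w` is finite,
`finite_residueField_adicCompletion`). [folklore] -/
theorem exists_residueSystem :
    ∃ (ι : Type) (_ : Fintype ι) (b : ι → w.adicCompletion K),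
      (∀ i, Valued.v (b i) ≤ 1) ∧
      (∀ x : w.adicCompletion K, Valued.v x ≤ 1 → ∃ i, Valued.v (x - b i) < 1) ∧
      ∀ i j, Valued.v (b i - b j) < 1 → i = j := by
  classical
  haveI : Finite (Valued.ResidueField (w.adicCompletion K)) := finite_residueField_adicCompletion K w
  letI : Fintype (Valued.ResidueField (w.adicCompletion K)) := Fintype.ofFinite _
  have hres : Function.Surjective (IsLocalRing.residue (Valued.integer (w.adicCompletion K))) :=
    IsLocalRing.residue_surjective
  set s : Valued.ResidueField (w.adicCompletion K) → Valued.integer (w.adicCompletion K) :=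
    Function.surjInv hres with hs
  have hss : ∀ r, IsLocalRing.residue _ (s r) = r := fun r => Function.surjInv_eq hres r
  have hmax : ∀ z : Valued.integer (w.adicCompletion K),
      z ∈ IsLocalRing.maximalIdeal _ ↔ Valued.v (z : w.adicCompletion K) < 1 := fun z => by
    rw [IsLocalRing.mem_maximalIdeal, mem_nonunits_iff]
    exact Valuation.Integer.not_isUnit_iff_valuation_lt_one
  have hres_eq : ∀ a c : Valued.integer (w.adicCompletion K),
      IsLocalRing.residue _ a = IsLocalRing.residue _ c ↔ a - c ∈ IsLocalRing.maximalIdeal _ :=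
    fun a c => Ideal.Quotient.eq
  refine ⟨Valued.ResidueField (w.adicCompletion K), inferInstance,
    fun r => ((s r : Valued.integer (w.adicCompletion K)) : w.adicCompletion K),
    fun r => (Valuation.mem_integer_iff _ _).1 (s r).2, fun x hx => ?_, fun i j hij => ?_⟩
  · let z : Valued.integer (w.adicCompletion K) := ⟨x, (Valuation.mem_integer_iff _ _).2 hx⟩
    refine ⟨IsLocalRing.residue _ z, ?_⟩
    have h : s (IsLocalRing.residue _ z) - z ∈ IsLocalRing.maximalIdeal _ :=
      (hres_eq _ _).1 (hss _)
    have h' := (hmax _).1 h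
    rw [AddSubgroupClass.coe_sub, Valuation.map_sub_swap] at h'
    exact h'
  · have h : s i - s j ∈ IsLocalRing.maximalIdeal _ :=
      (hmax _).2 (by rwa [AddSubgroupClass.coe_sub])
    rw [← hres_eq, hss, hss] at h
    exact h

end Residues

namespace BigHeckeGLn

variable {K : Type} [Field K] [NumberField K]

/-! ### The Borel Hecke elements at `w` -/

section Elements

variable (S : Set (HeightOneSpectrum (𝓞 K))) (w : HeightOneSpectrum (𝓞 K))

/-- `t₁ = diag(ϖ_w, 1) ∈ GL₂(K_w)`. [folklore] -/
abbrev localT₁ : GL (Fin 2) (w.adicCompletion K) :=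
  heckeLocalDiag ((uniformizerAt w : (w.adicCompletion K)ˣ) : w.adicCompletion K)
    (uniformizerAt w).ne_zero

/-- `t₂ = diag(1, ϖ_w) ∈ GL₂(K_w)`. [folklore] -/
abbrev localT₂ : GL (Fin 2) (w.adicCompletion K) :=
  heckeLocalDiag' ((uniformizerAt w : (w.adicCompletion K)ˣ) : w.adicCompletion K)
    (uniformizerAt w).ne_zero

/-- **`t^B_1 = ι_w(diag(ϖ_w, 1)) ∈ H_S`.** [cite: Harder1987, §2] -/
def borelHeckeElement₁ : borelAwayFrom (n := 2) S :=
  ofBorelLocal S w ⟨localT₁ w, heckeLocalDiag_mem_borelGL2 _ _⟩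

/-- **`t^B_2 = ι_w(diag(1, ϖ_w)) ∈ H_S`.** [cite: Harder1987, §2] -/
def borelHeckeElement₂ : borelAwayFrom (n := 2) S :=
  ofBorelLocal S w ⟨localT₂ w, heckeLocalDiag'_mem_borelGL2 _ _⟩

/-- `t_{w,1} = ι_w(t₁)`. [folklore] -/
theorem heckeElement_one_eq_ofLocal_localT₁ : heckeElement 2 K w 1 = ofLocal 2 K w (localT₁ w) := by
  rw [heckeElement_eq_ofLocal]
  change _ = ofLocal 2 K w (heckeLocalDiag _ _)
  rw [heckeLocalDiag_eq_glDiagonal]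

/-- `t^B_1` is the Hecke element `t_{w,1}` of `GL₂(𝔸_K^∞)`. [folklore] -/
theorem coe_borelHeckeElement₁ :
    ((borelHeckeElement₁ S w : borelAwayFrom (n := 2) S) : FiniteAdelicGL 2 K) = heckeElement 2 K w 1 := by
  rw [heckeElement_one_eq_ofLocal_localT₁]
  rfl

/-- `t^B_2 = ι_w(t₂)`. [folklore] -/
theorem coe_borelHeckeElement₂ :
    ((borelHeckeElement₂ S w : borelAwayFrom (n := 2) S) : FiniteAdelicGL 2 K) =
      ofLocal 2 K w (localT₂ w) := rfl

end Elements

/-! ### The double cosets -/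

section Cosets

variable {S : Set (HeightOneSpectrum (𝓞 K))} {w : HeightOneSpectrum (𝓞 K)} (hw : w ∉ S)
  {U : Subgroup (FiniteAdelicGL 2 K)}
  (hU : ArithmeticQuotient.IsUnramifiedLevel
    (valuedCongruenceSubgroup (Fin 2) (1 : WithZero (Multiplicative ℤ)))
    (ofLocal 2 K w) (localComponent 2 K w) U)

/-- `⋃ over Bool`. [folklore] -/
private theorem iUnion_bool_eq {α : Type*} (f : Bool → Set α) : (⋃ j, f j) = f true ∪ f false :=
  Set.ext fun c => by simp only [Set.mem_iUnion, Bool.exists_bool, Set.mem_union, or_comm]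

/-- Membership in `L g L / L`: the cosets `l g L`, `l ∈ L`. [folklore] -/
private theorem mem_doubleCosetQuot_iff' {G : Type*} [Group G] (L : Subgroup G) (g : G)
    (d : G ⧸ L) :
    d ∈ ArithmeticQuotient.doubleCosetQuot L g ↔ ∃ l ∈ L, d = ((l * g : G) : G ⧸ L) := by
  constructor
  · rintro ⟨m, rfl⟩
    exact ⟨m, m.2, rfl⟩
  · rintro ⟨l, hl, rfl⟩
    exact ⟨⟨l, hl⟩, rfl⟩

include hw hU

/-- **The `H_S`-double coset of `ι_w(a)` inside `𝒢 ⧸ U`**: for `a ∈ B(K_w)`,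
`toQuot ((U ∩ H_S) ι_w(a) (U ∩ H_S) / (U ∩ H_S)) = {ι_w(l a) U : l ∈ B(K_w) ∩ GL₂(𝒪_w)}`
(an element `m ∈ U ∩ H_S` acts on `ι_w(a) U` through its `w`-component, which lies in
`B(K_w) ∩ GL₂(𝒪_w)`; `IsUnramifiedLevel.mk_mul_map`). [cite: Harder1987, §2] -/
theorem image_toQuot_doubleCosetQuot_ofBorelLocal (a : borelGL2 (w.adicCompletion K)) :
    TwistedQuotient.toQuot U (borelAwayFrom S) ''
        ArithmeticQuotient.doubleCosetQuot (U.subgroupOf (borelAwayFrom S))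
          (ofBorelLocal (n := 2) S w a : borelAwayFrom (n := 2) S) =
      {c | ∃ l ∈ borelGL2 (w.adicCompletion K) ⊓ GL2Int (w.adicCompletion K),
        c = (((ofLocal 2 K w ((l : GL (Fin 2) (w.adicCompletion K)) * a)) : FiniteAdelicGL 2 K) :
          FiniteAdelicGL 2 K ⧸ U)} := by
  ext c
  simp only [Set.mem_image, mem_doubleCosetQuot_iff', Set.mem_setOf_eq]
  constructor
  · rintro ⟨d, ⟨m, hm, rfl⟩, rfl⟩
    refine ⟨localComponent 2 K w (m : FiniteAdelicGL 2 K),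
      ⟨(mem_borelAwayFrom_iff.1 m.2) w hw, hU.apply_mem (Subgroup.mem_subgroupOf.1 hm)⟩, ?_⟩
    rw [TwistedQuotient.toQuot_mk, Subgroup.coe_mul, coe_ofBorelLocal,
      hU.mk_mul_map _ (Subgroup.mem_subgroupOf.1 hm)]
  · rintro ⟨l, hl, rfl⟩
    have hlH : ofLocal 2 K w l ∈ borelAwayFrom (n := 2) S :=
      ofLocal_mem_borelAwayFrom fun _ => (Subgroup.mem_inf.1 hl).1
    refine ⟨((⟨ofLocal 2 K w l, hlH⟩ * ofBorelLocal S w a : borelAwayFrom (n := 2) S) :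
        borelAwayFrom (n := 2) S ⧸ U.subgroupOf (borelAwayFrom S)),
      ⟨⟨ofLocal 2 K w l, hlH⟩, Subgroup.mem_subgroupOf.2 (hU.map_mem (Subgroup.mem_inf.1 hl).2),
        rfl⟩, ?_⟩
    rw [TwistedQuotient.toQuot_mk, Subgroup.coe_mul, coe_ofBorelLocal, ← map_mul]

/-- The `t₁`-piece. [folklore] -/
theorem image_toQuot_doubleCosetQuot_borelHeckeElement₁ :
    TwistedQuotient.toQuot U (borelAwayFrom S) ''
        ArithmeticQuotient.doubleCosetQuot (U.subgroupOf (borelAwayFrom S))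
          (borelHeckeElement₁ S w : borelAwayFrom (n := 2) S) =
      {c | ∃ l ∈ borelGL2 (w.adicCompletion K) ⊓ GL2Int (w.adicCompletion K),
        c = (((ofLocal 2 K w ((l : GL (Fin 2) (w.adicCompletion K)) * localT₁ w)) : FiniteAdelicGL 2 K) :
          FiniteAdelicGL 2 K ⧸ U)} :=
  image_toQuot_doubleCosetQuot_ofBorelLocal hw hU _

/-- The `t₂`-piece is the single coset `ι_w(t₂) U`. [folklore] -/
theorem image_toQuot_doubleCosetQuot_borelHeckeElement₂ :
    TwistedQuotient.toQuot U (borelAwayFrom S) ''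
        ArithmeticQuotient.doubleCosetQuot (U.subgroupOf (borelAwayFrom S))
          (borelHeckeElement₂ S w : borelAwayFrom (n := 2) S) =
      {((ofLocal 2 K w (localT₂ w) : FiniteAdelicGL 2 K) : FiniteAdelicGL 2 K ⧸ U)} := by
  have hϖ1 : Valued.v ((uniformizerAt w : (w.adicCompletion K)ˣ) : (w.adicCompletion K)) ≤ 1 := by
    rw [valued_coe_uniformizerAt, ← WithZero.exp_zero, WithZero.exp_le_exp]; omega
  rw [borelHeckeElement₂, image_toQuot_doubleCosetQuot_ofBorelLocal hw hU]
  ext c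
  simp only [Set.mem_setOf_eq, Set.mem_singleton_iff]
  constructor
  · rintro ⟨l, hl, rfl⟩
    change hU.localCoset (((l * localT₂ w : GL (Fin 2) (w.adicCompletion K))) : GL (Fin 2) (w.adicCompletion K) ⧸ GL2Int (w.adicCompletion K)) =
      hU.localCoset ((localT₂ w : GL (Fin 2) (w.adicCompletion K)) : GL (Fin 2) (w.adicCompletion K) ⧸ GL2Int (w.adicCompletion K))
    rw [mul_heckeLocalDiag'_coset_eq _ _ hϖ1 (Subgroup.mem_inf.1 hl).1 (Subgroup.mem_inf.1 hl).2]
  · rintro rfl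
    exact ⟨1, one_mem _, by rw [one_mul]⟩

omit hw in
/-- The `𝒢`-side: `U t_{w,1} U / U = {ι_w(l t₁) U : l ∈ B ∩ K} ∪ {ι_w(t₂) U}`. [folklore] -/
theorem doubleCosetQuot_heckeElement_one_eq_union :
    ArithmeticQuotient.doubleCosetQuot U (heckeElement 2 K w 1) =
      {c | ∃ l ∈ borelGL2 (w.adicCompletion K) ⊓ GL2Int (w.adicCompletion K),
        c = (((ofLocal 2 K w ((l : GL (Fin 2) (w.adicCompletion K)) * localT₁ w)) : FiniteAdelicGL 2 K) :
          FiniteAdelicGL 2 K ⧸ U)} ∪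
      {((ofLocal 2 K w (localT₂ w) : FiniteAdelicGL 2 K) : FiniteAdelicGL 2 K ⧸ U)} := by
  obtain ⟨ι, _, b, hbint, hb, -⟩ := exists_residueSystem K w
  have hϖ := valued_coe_uniformizerAt (K := K) w
  rw [heckeElement_one_eq_ofLocal_localT₁, ← (hU.bijOn_localCoset _).image_eq]
  change hU.localCoset '' MulAction.orbit _ ((localT₁ w : GL (Fin 2) (w.adicCompletion K)) : GL (Fin 2) (w.adicCompletion K) ⧸ GL2Int (w.adicCompletion K)) = _
  rw [orbit_heckeLocalDiag_eq _ b _ hϖ hbint hb, Set.image_union, Set.image_singleton,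
    hU.localCoset_mk]
  congr 1
  ext c
  simp only [Set.mem_image, Set.mem_setOf_eq]
  constructor
  · rintro ⟨_, ⟨l, hl, rfl⟩, rfl⟩
    exact ⟨l, hl, by rw [hU.localCoset_mk]⟩
  · rintro ⟨l, hl, rfl⟩
    exact ⟨_, ⟨l, hl, rfl⟩, by rw [hU.localCoset_mk]⟩

/-- **`U t_{w,1} U / U` from the Borel**: it is the union of the images of the two `H_S`-double
cosets of `t^B_1` and `t^B_2`. [cite: Harder1987, §2] -/
theorem doubleCosetQuot_heckeElement_one_eq :
    ArithmeticQuotient.doubleCosetQuot U (heckeElement 2 K w 1) =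
      ⋃ j : Bool, TwistedQuotient.toQuot U (borelAwayFrom S) ''
        ArithmeticQuotient.doubleCosetQuot (U.subgroupOf (borelAwayFrom S))
          (cond j (borelHeckeElement₁ S w) (borelHeckeElement₂ S w) : borelAwayFrom (n := 2) S) := by
  rw [iUnion_bool_eq]
  change _ = TwistedQuotient.toQuot U (borelAwayFrom S) ''
        ArithmeticQuotient.doubleCosetQuot (U.subgroupOf (borelAwayFrom S)) (borelHeckeElement₁ S w) ∪
      TwistedQuotient.toQuot U (borelAwayFrom S) ''
        ArithmeticQuotient.doubleCosetQuot (U.subgroupOf (borelAwayFrom S)) (borelHeckeElement₂ S w)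
  rw [image_toQuot_doubleCosetQuot_borelHeckeElement₁ hw hU,
    image_toQuot_doubleCosetQuot_borelHeckeElement₂ hw hU,
    doubleCosetQuot_heckeElement_one_eq_union hU]

/-- **The two `H_S`-double cosets are disjoint** (in `H_S ⧸ (U ∩ H_S)`). [cite: Harder1987, §2] -/
theorem disjoint_doubleCosetQuot_borelHeckeElement :
    Disjoint
      (ArithmeticQuotient.doubleCosetQuot (U.subgroupOf (borelAwayFrom S))
        (borelHeckeElement₁ S w : borelAwayFrom (n := 2) S))
      (ArithmeticQuotient.doubleCosetQuot (U.subgroupOf (borelAwayFrom S))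
        (borelHeckeElement₂ S w : borelAwayFrom (n := 2) S)) := by
  obtain ⟨ι, _, b, hbint, hb, hbinj⟩ := exists_residueSystem K w
  have hϖ := valued_coe_uniformizerAt (K := K) w
  rw [← Set.disjoint_image_iff (TwistedQuotient.toQuot_injective U (borelAwayFrom S)),
    image_toQuot_doubleCosetQuot_borelHeckeElement₁ hw hU,
    image_toQuot_doubleCosetQuot_borelHeckeElement₂ hw hU, Set.disjoint_singleton_right]
  rintro ⟨l, hl, hc⟩
  rw [← hU.localCoset_mk, ← hU.localCoset_mk] at hc
  have hc' := hU.localCoset_injective hc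
  refine borelInt_mul_heckeLocalDiag_ne _ b (uniformizerAt w).ne_zero hϖ hbint hb hbinj
    (Subgroup.mem_inf.1 hl).1 (Subgroup.mem_inf.1 hl).2 (one_mem _) (one_mem _) ?_
  rw [one_mul]
  exact hc'.symm

omit hw in
/-- The `𝒢`-double coset of `t_{w,1}` is finite (`q_w + 1` cosets). [folklore] -/
theorem finite_doubleCosetQuot_heckeElement_one :
    (ArithmeticQuotient.doubleCosetQuot U (heckeElement 2 K w 1)).Finite := by
  obtain ⟨ι, _, b, hbint, hb, -⟩ := exists_residueSystem K w
  have hϖ := valued_coe_uniformizerAt (K := K) w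
  rw [doubleCosetQuot_heckeElement_one_eq_union hU]
  refine Set.Finite.union (Set.Finite.subset (Set.finite_range fun i : ι =>
    ((ofLocal 2 K w (heckeLocalRep ((uniformizerAt w : (w.adicCompletion K)ˣ) : (w.adicCompletion K)) b
      (uniformizerAt w).ne_zero (some i)) : FiniteAdelicGL 2 K) : FiniteAdelicGL 2 K ⧸ U)) ?_)
    (Set.finite_singleton _)
  rintro _ ⟨l, hl, rfl⟩
  obtain ⟨i, hi⟩ := exists_borelInt_mul_heckeLocalDiag_coset_eq _ b _ hϖ hbint hb
    (Subgroup.mem_inf.1 hl).1 (Subgroup.mem_inf.1 hl).2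
  refine ⟨i, ?_⟩
  change ((ofLocal 2 K w _ : FiniteAdelicGL 2 K) : FiniteAdelicGL 2 K ⧸ U) = _
  rw [← hU.localCoset_mk, ← hU.localCoset_mk, hi]

/-- The `H_S`-double cosets of `t^B_1`, `t^B_2` are finite. [folklore] -/
theorem finite_doubleCosetQuot_borelHeckeElement (j : Bool) :
    (ArithmeticQuotient.doubleCosetQuot (U.subgroupOf (borelAwayFrom S))
      (cond j (borelHeckeElement₁ S w) (borelHeckeElement₂ S w) : borelAwayFrom (n := 2) S)).Finite := by
  refine Set.Finite.of_finite_image ?_ (TwistedQuotient.toQuot_injective U (borelAwayFrom S)).injOn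
  refine (finite_doubleCosetQuot_heckeElement_one hU).subset ?_
  rw [doubleCosetQuot_heckeElement_one_eq hw hU]
  exact Set.subset_iUnion (fun j : Bool => TwistedQuotient.toQuot U (borelAwayFrom S) ''
    ArithmeticQuotient.doubleCosetQuot (U.subgroupOf (borelAwayFrom S))
      (cond j (borelHeckeElement₁ S w) (borelHeckeElement₂ S w) : borelAwayFrom (n := 2) S)) j

end Cosets

/-! ### On twisted cohomology -/

section Cohomology

universe u

variable {S : Set (HeightOneSpectrum (𝓞 K))} {w : HeightOneSpectrum (𝓞 K)} (hw : w ∉ S)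
  {U : Subgroup (FiniteAdelicGL 2 K)}
  (hU : ArithmeticQuotient.IsUnramifiedLevel
    (valuedCongruenceSubgroup (Fin 2) (1 : WithZero (Multiplicative ℤ)))
    (ofLocal 2 K w) (localComponent 2 K w) U)
  {k : Type} [CommRing k] {Γ : Type} [Group Γ] (ι : Γ →* FiniteAdelicGL 2 K)
  (hι : ∀ γ, ι γ ∈ borelAwayFrom (n := 2) S)
  {V : Type} [AddCommGroup V] [Module k V] (ρ : Representation k Γ V)

include hw hU

/-- **`res (T_{w,1} x) = T^B_{t₁} (res x) + T^B_{t₂} (res x)`** on twisted cohomology: restricting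
`H^q(Γ, Fun(𝒢/U, V))` to the Borel model `H^q(Γ, Fun(H_S/(U ∩ H_S), V))` intertwines the
`GL₂`-Hecke operator `T_{w,1}` with the sum of the two Borel Hecke operators of `ι_w(diag(ϖ,1))` and
`ι_w(diag(1,ϖ))`. [cite: Harder1987, §2] -/
theorem subgroupRestrictMap_heckeEnd_heckeElement_one (q : ℕ)
    (x : TwistedQuotient.cohomology ι U ρ q) :
    (TwistedQuotient.subgroupRestrictMap ι U ρ (borelAwayFrom S) hι q).hom
        (TwistedQuotient.heckeEnd ι U ρ (heckeElement 2 K w 1) q x) =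
      TwistedQuotient.heckeEnd (ι.codRestrict _ hι) (U.subgroupOf (borelAwayFrom S)) ρ
          (borelHeckeElement₁ S w) q
          ((TwistedQuotient.subgroupRestrictMap ι U ρ (borelAwayFrom S) hι q).hom x) +
        TwistedQuotient.heckeEnd (ι.codRestrict _ hι) (U.subgroupOf (borelAwayFrom S)) ρ
          (borelHeckeElement₂ S w) q
          ((TwistedQuotient.subgroupRestrictMap ι U ρ (borelAwayFrom S) hι q).hom x) := by
  have h := TwistedQuotient.subgroupRestrictMap_heckeEnd_apply ι U ρ (borelAwayFrom S) hι
    (J := Bool) (fun j => cond j (borelHeckeElement₁ S w) (borelHeckeElement₂ S w))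
    (fun j => finite_doubleCosetQuot_borelHeckeElement hw hU j)
    (doubleCosetQuot_heckeElement_one_eq hw hU) (fun j j' hjj' => ?_) q x
  · rw [h, Fintype.sum_bool]
    rfl
  · cases j <;> cases j'
    · exact absurd rfl hjj'
    · exact (disjoint_doubleCosetQuot_borelHeckeElement hw hU).symm
    · exact disjoint_doubleCosetQuot_borelHeckeElement hw hU
    · exact absurd rfl hjj'

end Cohomology

end BigHeckeGLn

end Literature.NumberTheory.Automorphic
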